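import Summits.CriticalPhenomena.CardyFormulaZ2.Theorems.StripClusterRates.Negative.SubmultiplicativeOne
import Summits.CriticalPhenomena.CardyFormulaZ2.Theorems.CardyBoundaryCoulombGasStripClusterRatesStubSandwichUpper

/-!
# Stub `co_kacOne_of_cardyOrderOne` (S1) of line `two-cluster-rate-is-stationary-gap`
# (crux `CardyBoundaryCoulombGas.StripClusterRates`, stmt-CriticalPhenomena-13878, reshape 6, lead c7)

**CO₁ ⟹ K₁.** Write `p₁(m,n) = crossingProb half m n` for the probability of an open left–right
crossing of `[0,m]×[0,n]` in bond percolation on `ℤ²` at `p = 1/2`, and `γ₁(n) = lim_m −log p₁(m,n)/m`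
for the lengthwise (transfer-matrix order) decay rate of ONE spanning cluster in the free strip of
width `n`. The *Cardy-order one-cluster Kac* hypothesis CO₁ asks for two functions `g, G : ℕ → ℝ`
with `g(A)/A → π/3`, `G(A)/A → π/3` and, for every integer aspect ratio `A ≥ 1`, the eventual
(in `n`) two-sided bounds `e^{−G(A)} ≤ p₁(A·n, n) ≤ e^{−g(A)}`. This file proves that CO₁ forces
`n·γ(n) → π/3` for EVERY family `γ` of one-cluster rates (`−log p₁(m,n)/m → γ(n)` for `n ≥ 1`).

Proof (two-sided Fekete sandwich, the architecture of the landed `stub_composeOne`).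
* LOWER. Sub-multiplicativity over disjoint blocks (`Negative.rateOne_ge_finite`:
  `γ(n) ≥ −log p₁(m,n)/(m+1)` for every `m`) at `m = A·n` and `p₁(A·n,n) ≤ e^{−g(A)}` give
  `n·γ(n) ≥ n·g(A)/(A·n+1) → g(A)/A`.
* UPPER. Width-uniform super-multiplicativity (`stub_sandwichUpper`:
  `γ(n) ≤ (log 2 − log p₁(m,n))/(m − n)` for `m > n`) at `m = A·n`, `A ≥ 2`, and
  `e^{−G(A)} ≤ p₁(A·n,n)` give `n·γ(n) ≤ (log 2 + G(A))/(A − 1)`.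
* Given `ε > 0` choose ONE aspect ratio `A ≥ 2` with `g(A)/A > π/3 − ε/2` and
  `(log 2 + G(A))/(A − 1) < π/3 + ε/2` (`co1k_tendsto_upperConst`: `G(A)/A → L` implies
  `(log 2 + G(A))/(A−1) → L`); then for all large `n` both eventual bounds hold and
  `n·g(A)/(A·n+1) > π/3 − ε`, whence `|n·γ(n) − π/3| < ε`.

No definitions. Helper lemmas are prefixed `co1k_` (positivity of `p₁` is inlined from `pOne_ge`;
the landed `g_pOne_pos` lives in `StubComposeOne`, whose Kleban–Zagier imports are not needed
here). References: M. Fekete (1923); [Cardy1998].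
-/

noncomputable section

open MeasureTheory Filter Topology Set
open Literature.Probability.LatticeModels Literature.Probability.Percolation

namespace Summit.CriticalPhenomena.CardyFormulaZ2.Cruxes.StripClusterRates.TwoClusterRateIsStationaryGap

open Summit.CriticalPhenomena.CardyFormulaZ2.Theorems.StripClusterRates.Negative (pOne pOne_ge
  rateOne_ge_finite rateSeqOne)

/-! ## Small analytic facts -/

/-- `A/(A − 1) → 1` along the natural numbers. [folklore] -/
theorem co1k_tendsto_div_sub_one : Tendsto (fun A : ℕ ↦ (A : ℝ) / ((A : ℝ) - 1)) atTop (𝓝 1) := by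
  have hinv : Tendsto (fun A : ℕ ↦ (A : ℝ)⁻¹) atTop (𝓝 0) := tendsto_inv_atTop_nhds_zero_nat
  have h1 : Tendsto (fun A : ℕ ↦ (1 : ℝ) / (1 - (A : ℝ)⁻¹)) atTop (𝓝 (1 / (1 - 0))) :=
    tendsto_const_nhds.div (tendsto_const_nhds.sub hinv) (by norm_num)
  rw [sub_zero, div_one] at h1
  refine h1.congr' ?_
  filter_upwards [eventually_ge_atTop 2] with A hA
  have hA' : (2 : ℝ) ≤ A := by exact_mod_cast hA
  have hA0 : (A : ℝ) ≠ 0 := by positivity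
  field_simp

/-- **The upper Cardy-order constant.** If `G(A)/A → L` then `(log 2 + G(A))/(A − 1) → L`
(write `(log 2 + G(A))/(A − 1) = (log 2/A + G(A)/A)·(A/(A − 1))`). [folklore] -/
theorem co1k_tendsto_upperConst {G : ℕ → ℝ} {L : ℝ}
    (hG : Tendsto (fun A : ℕ ↦ G A / A) atTop (𝓝 L)) :
    Tendsto (fun A : ℕ ↦ (Real.log 2 + G A) / ((A : ℝ) - 1)) atTop (𝓝 L) := by
  have h2 : Tendsto (fun A : ℕ ↦ Real.log 2 / (A : ℝ)) atTop (𝓝 0) :=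
    tendsto_const_div_atTop_nhds_zero_nat _
  have hsum := (h2.add hG).mul co1k_tendsto_div_sub_one
  rw [zero_add, mul_one] at hsum
  refine hsum.congr' ?_
  filter_upwards [eventually_ge_atTop 2] with A hA
  have hA' : (2 : ℝ) ≤ A := by exact_mod_cast hA
  have hA0 : (A : ℝ) ≠ 0 := by positivity
  have hA1 : (A : ℝ) - 1 ≠ 0 := by linarith
  field_simp

/-- **The lower comparison sequence**: `n·(c/(A·n + 1)) → c/A` (`A ≥ 1`). [folklore] -/
theorem co1k_tendsto_lowerSeq {A : ℕ} (hA : 1 ≤ A) (c : ℝ) :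
    Tendsto (fun n : ℕ ↦ (n : ℝ) * (c / (((A * n : ℕ) : ℝ) + 1))) atTop (𝓝 (c / A)) := by
  have hA0 : (0 : ℝ) < A := by exact_mod_cast hA
  have h1 : Tendsto (fun n : ℕ ↦ (c / (A : ℝ)) * ((n : ℝ) / (n + 1 / (A : ℝ)))) atTop
      (𝓝 ((c / (A : ℝ)) * 1)) :=
    tendsto_const_nhds.mul (tendsto_natCast_div_add_atTop (1 / (A : ℝ)))
  rw [mul_one] at h1
  refine h1.congr' (Eventually.of_forall fun n ↦ ?_)
  have hn0 : (0 : ℝ) ≤ n := by positivity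
  have hd : (n : ℝ) * A + 1 ≠ 0 := by positivity
  have hd' : (A : ℝ) * n + 1 ≠ 0 := by positivity
  dsimp only
  push_cast
  field_simp

/-! ## The two halves of the sandwich at a fixed aspect ratio -/

/-- **Upper half at aspect ratio `A ≥ 2`.** If `γ` is a one-cluster rate at width `n ≥ 1` and
`e^{−G} ≤ p₁(A·n, n)`, then `n·γ ≤ (log 2 + G)/(A − 1)` (`stub_sandwichUpper` at `m = A·n`). [folklore] -/
theorem co1k_nMul_rate_le {A n : ℕ} (hA : 2 ≤ A) (hn : 1 ≤ n) {γ G : ℝ}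
    (hγ : Tendsto (fun m : ℕ ↦ -Real.log (crossingProb half m n) / (m : ℝ)) atTop (𝓝 γ))
    (hbl : Real.exp (-G) ≤ crossingProb half (A * n) n) :
    (n : ℝ) * γ ≤ (Real.log 2 + G) / ((A : ℝ) - 1) := by
  have hAr : (2 : ℝ) ≤ A := by exact_mod_cast hA
  have hn0 : (0 : ℝ) ≤ n := by positivity
  have hnr : (1 : ℝ) ≤ n := by exact_mod_cast hn
  have hlt : n < A * n := by
    have : 2 * n ≤ A * n := Nat.mul_le_mul_right n hA
    omega
  have hsu := stub_sandwichUpper n hn γ hγ (A * n) hlt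
  have hlogl : -G ≤ Real.log (crossingProb half (A * n) n) := by
    have := Real.log_le_log (Real.exp_pos _) hbl
    rwa [Real.log_exp] at this
  have hden : ((A * n : ℕ) : ℝ) - n = ((A : ℝ) - 1) * n := by push_cast; ring
  have hA1r : (0 : ℝ) < (A : ℝ) - 1 := by linarith
  have hdpos : (0 : ℝ) < ((A : ℝ) - 1) * n := by positivity
  rw [hden] at hsu
  have h1 : γ ≤ (Real.log 2 + G) / (((A : ℝ) - 1) * n) :=
    hsu.trans (div_le_div_of_nonneg_right (by linarith) hdpos.le)
  have hn0' : (n : ℝ) ≠ 0 := by positivity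
  calc (n : ℝ) * γ ≤ (n : ℝ) * ((Real.log 2 + G) / (((A : ℝ) - 1) * n)) :=
        mul_le_mul_of_nonneg_left h1 hn0
    _ = (Real.log 2 + G) / ((A : ℝ) - 1) := by
        field_simp

/-- **Lower half at aspect ratio `A`.** If `γ` is a one-cluster rate at width `n` and
`p₁(A·n, n) ≤ e^{−g}`, then `n·(g/(A·n + 1)) ≤ n·γ` (`Negative.rateOne_ge_finite` at `m = A·n`). [folklore] -/
theorem co1k_nMul_rate_ge {A n : ℕ} {γ g : ℝ}
    (hγ : Tendsto (fun m : ℕ ↦ -Real.log (crossingProb half m n) / (m : ℝ)) atTop (𝓝 γ))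
    (hbu : crossingProb half (A * n) n ≤ Real.exp (-g)) :
    (n : ℝ) * (g / (((A * n : ℕ) : ℝ) + 1)) ≤ (n : ℝ) * γ := by
  have hn0 : (0 : ℝ) ≤ n := by positivity
  have hrl : -Real.log (crossingProb half (A * n) n) / (((A * n : ℕ) : ℝ) + 1) ≤ γ :=
    rateOne_ge_finite hγ (A * n)
  -- `0 < p₁(A·n, n)` by the landed `pOne_ge : 2⁻ᵐ ≤ p₁(m,n)` (cf. `g_pOne_pos` of `StubComposeOne`)
  have hp : 0 < crossingProb half (A * n) n := lt_of_lt_of_le (by positivity) (pOne_ge (A * n) n)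
  have hlogu : Real.log (crossingProb half (A * n) n) ≤ -g := by
    have := Real.log_le_log hp hbu
    rwa [Real.log_exp] at this
  refine mul_le_mul_of_nonneg_left (le_trans ?_ hrl) hn0
  exact div_le_div_of_nonneg_right (by linarith) (by positivity)

/-! ## The registered stub -/

/-- **S1 — `co_kacOne_of_cardyOrderOne` (CO₁ ⟹ K₁).** The Cardy-order one-cluster Kac hypothesis —
functions `g, G : ℕ → ℝ` with `g(A)/A → π/3`, `G(A)/A → π/3` and, for every integer aspect ratio
`A ≥ 1`, eventually in `n` the two-sided bounds `e^{−G(A)} ≤ p₁(A·n, n) ≤ e^{−g(A)}`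
(`p₁(m,n) = crossingProb half m n`, bond percolation on `ℤ²` at `p = 1/2`) — implies that every
family `γ` of one-cluster rates (`−log p₁(m,n)/m → γ(n)` for every width `n ≥ 1`) has
`n·γ(n) → π/3`: the two-sided Fekete sandwich `n·g(A)/(A·n+1) ≤ n·γ(n) ≤ (log 2 + G(A))/(A−1)`
(sub-multiplicativity over disjoint blocks / width-uniform gluing super-multiplicativity), whose two
ends tend to `g(A)/A` and `(log 2 + G(A))/(A − 1)`, both within `ε/2` of `π/3` for a suitable `A`. [folklore] -/
theorem co_kacOne_of_cardyOrderOne : (∃ g G : ℕ → ℝ, Tendsto (fun A : ℕ ↦ g A / A) atTop (𝓝 (Real.pi / 3)) ∧ Tendsto (fun A : ℕ ↦ G A / A) atTop (𝓝 (Real.pi / 3)) ∧ ∀ A : ℕ, 1 ≤ A → ∀ᶠ n : ℕ in atTop, Real.exp (-G A) ≤ crossingProb half (A * n) n ∧ crossingProb half (A * n) n ≤ Real.exp (-g A)) → ∀ γ : ℕ → ℝ, (∀ n : ℕ, 1 ≤ n → Tendsto (fun m : ℕ ↦ -Real.log (crossingProb half m n) / (m : ℝ)) atTop (𝓝 (γ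 n))) → Tendsto (fun n : ℕ ↦ (n : ℝ) * γ n) atTop (𝓝 (Real.pi / 3)) := by
  rintro ⟨g, G, hg, hG, hb⟩ γ hγ
  rw [Metric.tendsto_atTop]
  intro ε hε
  -- Step 1: choose the aspect ratio `A ≥ 2`
  have hU := co1k_tendsto_upperConst hG
  obtain ⟨A, hA2, hAlow, hAup⟩ : ∃ A : ℕ, 2 ≤ A ∧ Real.pi / 3 - ε / 2 < g A / A ∧
      (Real.log 2 + G A) / ((A : ℝ) - 1) < Real.pi / 3 + ε / 2 := by
    have e1 := hg.eventually (lt_mem_nhds (show Real.pi / 3 - ε / 2 < Real.pi / 3 by linarith))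
    have e2 := hU.eventually (gt_mem_nhds (show Real.pi / 3 < Real.pi / 3 + ε / 2 by linarith))
    exact ((eventually_ge_atTop 2).and (e1.and e2)).exists.imp fun A h ↦ ⟨h.1, h.2.1, h.2.2⟩
  have hA1 : 1 ≤ A := le_trans (by norm_num) hA2
  -- Step 2: the lower comparison sequence at this `A` is eventually above `π/3 - ε`
  have elow := (co1k_tendsto_lowerSeq hA1 (g A)).eventually
    (lt_mem_nhds (show Real.pi / 3 - ε < g A / A by linarith))
  obtain ⟨N, hN⟩ := ((eventually_ge_atTop 1).and ((hb A hA1).and elow)).exists_forall_of_atTop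
  refine ⟨N, fun n hn ↦ ?_⟩
  obtain ⟨hn1, ⟨hbl, hbu⟩, hnlow⟩ := hN n hn
  -- Step 3: the sandwich at width `n`, length `A·n`
  have hupper := co1k_nMul_rate_le hA2 hn1 (hγ n hn1) hbl
  have hlower := co1k_nMul_rate_ge (hγ n hn1) hbu
  rw [Real.dist_eq, abs_sub_lt_iff]
  constructor <;> linarith

end Summit.CriticalPhenomena.CardyFormulaZ2.Cruxes.StripClusterRates.TwoClusterRateIsStationaryGap

end
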